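/-
Copyright (c) 2026. All rights reserved.
Released under Apache 2.0 license as described in the file LICENSE.
Authors: abc-iut cell, prover seat abc-iut-f-028 (F fact-proving wave), over the statements of abc-iut-L5-t4.
-/
import Literature.IUT.HodgeTheaters.ThetaPMEllHodgeTheatersF
import Literature.IUT.HodgeTheaters.PMBaseBridgePropsProofs
import HarnessLib

/-!
# [IUTchI] Cor 6.12 (i) ⟺ Cor 5.3 (ii) over every `ℱ`-kit — the exact strength of `FKit.Cor612iF` (proof-only)

S. Mochizuki, *Inter-universal Teichmüller theory I*, kurims manuscript (May 2020), §6 Cor 6.12 (i) p. 173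
("follow[s] immediately from Definition 6.11; Corollary 5.3, (ii)") and §5 Cor 5.3 (ii) p. 144
[claim: Mochizuki2012, status: disputed].  PROOF-ONLY companion (theorems only) of abc-iut-L5-t4's
`ThetaPMEllHodgeTheatersF.lean` and of `ThetaPMEllHodgeTheatersFClosures.lean` (abc-iut-f-028: the
universal closure of `FKit.Cor612iF`, FACT-LIST row F-2605, is FALSE over the fat toy kit).

Here the CONVERSE of L5-t4's `cor612iF_of_isomFtoDBijective` is PROVED, hypothesis-free over every kit with
`l ≠ 0` (`isomFtoDBijective_of_forall_isoFToDBijective`): if `IsoF.toD` is bijective for every pair of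
Θ^±-bridges of the kit, then `𝔉 ↦ 𝔇` is bijective on isomorphisms of `ℱ`-prime-strips (Cor 5.3 (ii),
`FKit.IsomFtoDBijective`).  Hence `cor612iF_iff_isomFtoDBijective`: over every kit, the named statement of
Cor 6.12 (i) has EXACTLY the strength of the named statement of Cor 5.3 (ii) — the schema row F-2605 is
neither weaker nor stronger than the Cor 5.3 (ii) row it is conditional on.  Method: two `ℱ`-prime-strips
`¹𝔉, ²𝔉` are the strips `†𝔇_≻`-lifts of the Θ^±-bridges "all constituents `ⁱ𝔉`, `𝒟`-data those of Example
6.2 transported along `ⁱ𝔇 ≅ 𝔇_≻`"; Prop 6.6 (i)'s construction (`DThetaPMBridge.Iso.exists_of`,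
DISCHARGED by abc-iut-L5) supplies an isomorphism of the associated `𝒟-Θ^±`-bridges with prescribed `+`-full
component through any `ψ : ¹𝔇 ⥲ ²𝔇`; surjectivity of `IsoF.toD` lifts `ψ`, injectivity of `IsoF.toD` forbids
two distinct `ℱ`-isomorphisms over `ψ` (add both to a lift, then delete one).  HONEST LABEL: a statement
about the INTERFACE `FKit`; nothing of [IUTchI] is asserted; no side taken on [IUTchIII] Cor 3.12.
-/

namespace Literature.IUT.HodgeTheaters

open CategoryTheory

namespace PMBaseKit

namespace FKit

/-! ### Converse: Cor 6.12 (i) for Θ^±-bridges FORCES Cor 5.3 (ii) — the exact strength of row F-2605 -/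

/-- **[IUTchI] Cor 6.12 (i) ⟹ Cor 5.3 (ii)** (kurims p.173 / p.144), INTERFACE LEVEL, hypothesis-free
converse of abc-iut-L5-t4's `cor612iF_of_isomFtoDBijective` (Θ^±-bridge clause alone suffices): if for
every pair of Θ^±-bridges of the kit the natural map `IsoF.toD` is bijective, then `𝔉 ↦ 𝔇` is bijective on
isomorphisms of `ℱ`-prime-strips.  Proof: embed two `ℱ`-prime-strips `¹𝔉, ²𝔉` as the strips `†𝔉_≻` of the
Θ^±-bridges "all constituents `ⁱ𝔉`, `𝒟`-data = Example 6.2 transported along `ⁱ𝔉 ↦ ⁱ𝔇 ≅ 𝔇_≻`"; an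
isomorphism of the associated `𝒟-Θ^±`-bridges with prescribed `+`-full component through `ψ : ¹𝔇 ⥲ ²𝔇`
exists (`DThetaPMBridge.Iso.exists_of`); surjectivity of `IsoF.toD` lifts `ψ`, and if two distinct
`φ₁, φ₂ : ¹𝔉 ⥲ ²𝔉` had the same image, adding both to a lift and then removing `φ₁` would give two distinct
lifts of one isomorphism.  (`NeZero l`: for `l = 0` there are no Θ^±-bridges at all.)
[claim: Mochizuki2012, status: disputed] -/
theorem isomFtoDBijective_of_forall_isoFToDBijective {l : ℕ} [NeZero l] {K : PMBaseKit l} {M : K.MultKit}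
    {FK : K.FKit M} (h : ∀ B₁ B₂ : FK.ThetaPMBridge, ThetaPMBridge.IsoFToDBijective B₁ B₂) :
    FK.IsomFtoDBijective := by
  classical
  -- the Θ^±-bridge all of whose strips are `F`, with the Example 6.2 `𝒟`-data read through `F ↦ 𝔇 ≅ 𝔇_≻`
  let e : ∀ F : FK.FStrip, (DStrip.model K).Iso F.assocD := fun F v => ((F.assocD.isLocal v).some).symm
  let br : FK.FStrip → FK.ThetaPMBridge := fun F =>
    { T := ZMod l
      grpT := FlPMGroup.tautological l
      capsule := fun _ => F
      codomain := F
      dPoly := fun z => DStrip.polyConj (e F) (e F) (Ex62.poly K z)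
      dPoly_model := ⟨Equiv.refl _, fun c hc => by simpa using hc, fun _ => e F, e F, fun _ => rfl⟩ }
  intro F₁ F₂
  have hg : ∀ ψ : F₁.assocD.Iso F₂.assocD, ∃ g : ThetaPMBridge.Iso (br F₁) (br F₂),
      g.codPoly = DStrip.plusFullPolyIso ψ := fun ψ => by
    obtain ⟨g, -, hg⟩ := DThetaPMBridge.Iso.exists_of (br F₁).dBridge (br F₂).dBridge (Equiv.refl _)
      (fun c hc => by
        change (Equiv.refl (ZMod l)).trans c ∈ (FlPMGroup.tautological l).charts
        rw [Equiv.refl_trans]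
        exact hc) ψ
    exact ⟨g, hg⟩
  have hmem : ∀ ψ : F₁.assocD.Iso F₂.assocD, ψ ∈ DStrip.plusFullPolyIso ψ := fun ψ =>
    ⟨1, one_mem _, funext fun v => (Iso.trans_refl (ψ v)).symm⟩
  refine ⟨fun φ₁ φ₂ hφ => ?_, fun ψ => ?_⟩
  · -- injectivity of `𝔉 ↦ 𝔇` on isomorphisms
    by_contra hne
    obtain ⟨g, hg⟩ := hg (FStrip.assocDMap φ₂)
    obtain ⟨G, rfl⟩ := (h (br F₁) (br F₂)).2 g
    let Q : Set (F₁.Iso F₂) := insert φ₁ (insert φ₂ G.codPoly)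
    -- any `Q' ⊆ Q` containing `φ₂` and `G.codPoly ∖ {φ₁}` still lifts the `†𝔇_≻`-component of `G.toD`
    have hlift : ∀ Q' : Set (F₁.Iso F₂), Q' ⊆ Q → φ₂ ∈ Q' → (∀ φ ∈ G.codPoly, φ ≠ φ₁ → φ ∈ Q') →
        FStrip.assocDMap '' Q' = G.toD.codPoly := by
      intro Q' h1 h2 h3
      apply le_antisymm
      · rintro _ ⟨χ, hχ, rfl⟩
        rcases h1 hχ with rfl | rfl | hχ'
        · rw [hφ, hg]; exact hmem _
        · rw [hg]; exact hmem _
        · rw [← G.codPoly_lifts]; exact ⟨χ, hχ', rfl⟩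
      · intro χ hχ
        rw [← G.codPoly_lifts] at hχ
        obtain ⟨φ, hφG, rfl⟩ := hχ
        by_cases hφ1 : φ = φ₁
        · subst hφ1
          exact ⟨φ₂, h2, hφ.symm⟩
        · exact ⟨φ, h3 φ hφG hφ1, rfl⟩
    have hQ : FStrip.assocDMap '' Q = G.toD.codPoly :=
      hlift Q subset_rfl (Set.mem_insert_of_mem _ (Set.mem_insert _ _))
        (fun φ hφG _ => Set.mem_insert_of_mem _ (Set.mem_insert_of_mem _ hφG))
    have hQ' : FStrip.assocDMap '' (Q \ {φ₁}) = G.toD.codPoly :=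
      hlift (Q \ {φ₁}) (fun _ hx => hx.1) ⟨Set.mem_insert_of_mem _ (Set.mem_insert _ _), fun h0 => hne (Eq.symm h0)⟩
        (fun φ hφG hφ1 => ⟨Set.mem_insert_of_mem _ (Set.mem_insert_of_mem _ hφG), hφ1⟩)
    let G₁ : ThetaPMBridge.IsoF (br F₁) (br F₂) := ⟨G.toD, G.capsPoly, Q, G.capsPoly_lifts, hQ⟩
    let G₂ : ThetaPMBridge.IsoF (br F₁) (br F₂) := ⟨G.toD, G.capsPoly, Q \ {φ₁}, G.capsPoly_lifts, hQ'⟩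
    have heq : G₁ = G₂ := (h (br F₁) (br F₂)).1 (rfl : G₁.toD = G₂.toD)
    have hcod : Q = Q \ {φ₁} := congrArg ThetaPMBridge.IsoF.codPoly heq
    have hφ₁ : φ₁ ∈ Q := Set.mem_insert _ _
    rw [hcod] at hφ₁
    exact hφ₁.2 rfl
  · -- surjectivity of `𝔉 ↦ 𝔇` on isomorphisms
    obtain ⟨g, hg⟩ := hg ψ
    obtain ⟨G, rfl⟩ := (h (br F₁) (br F₂)).2 g
    have hψ : ψ ∈ G.toD.codPoly := by rw [hg]; exact hmem ψ
    rw [← G.codPoly_lifts] at hψ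
    obtain ⟨φ, -, hφ⟩ := hψ
    exact ⟨φ, hφ⟩

/-- **[IUTchI] Cor 6.12 (i) ⟺ Cor 5.3 (ii)** over every `ℱ`-kit (`l ≠ 0`): the EXACT strength of the named
statement `FKit.Cor612iF` (row F-2605) is the named statement `FKit.IsomFtoDBijective` (Cor 5.3 (ii)) —
"follow[s] immediately from Definition 6.11; Corollary 5.3, (ii)" (p.173) and conversely.
[claim: Mochizuki2012, status: disputed] -/
theorem cor612iF_iff_isomFtoDBijective {l : ℕ} [NeZero l] {K : PMBaseKit l} {M : K.MultKit}
    (FK : K.FKit M) : FK.Cor612iF ↔ FK.IsomFtoDBijective :=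
  ⟨fun h => isomFtoDBijective_of_forall_isoFToDBijective h.1, cor612iF_of_isomFtoDBijective⟩

end FKit

end PMBaseKit

end Literature.IUT.HodgeTheaters
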